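import Summits.Schanuel.Schanuel.Theorems.RootDecomp1KGeneric13

/-!
# RootDecomp1K — «GENERIC CELLS», part 14: FINITE EXPONENTIAL ORDER — Piece KS at order `m + 6`: `pairApproxOrd_of_dependent`

Provenance: ROOT DECOMPOSITION CELL decomp-schanuel (D-0178), lens 6 «barrier-complement carving»,
gen 13, Stage E «FINITE ORDER»; source `ORD.lean` (lens publication dir `decomp-schanuel-lens-6/g13/addendum/`).
Supports `stmt-Schanuel-33363` (A₄ʰ) AND carves item `stmt-Schanuel-33364` (A₄ᵈ `FiniteOrderLiouvilleSchanuel`):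
the pieces KS and CF of parts 05–11 only ever use ONE good rational approximation of the ratio `ρ`, so they
hold for reals of a FIXED exponential Liouville order — hyper-Liouville or not — and NW96 Thm 1 closes the
cell as soon as that order exceeds the exponent of its pair measure.  Sorry-free; standard axioms; nothing
here proves Schanuel (rung 0).

Contents: §4 `pairApproxOrd_of_dependent` — the proof of `hyperPairApproxPoly_of_dependent` (part 11) verbatim
with ONE approximation of order `m + 6` and the fixed-exponent size budget of part 13.
-/

noncomputable section

open Complex Polynomial

namespace Summit.Schanuel.Schanuel.Theorems.RootDecomp1KGeneric

open Summit.Schanuel.Schanuel.Theorems.RootDecomp1KHyper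
open Summit.Schanuel.Schanuel.Theorems.RootDecomp1KHyper.HyperCell

/-! ## ORD 4. Piece KS at finite exponential order -/

set_option maxHeartbeats 1600000 in
/-- **Piece KS at FINITE exponential order (kernel, hypothesis-free).**  In the `n = 3` line cell with a
ratio `ρ > 0` of exponential Liouville order `m + 6` (hyper-Liouville or NOT), if `(e^u, ρ, e^{ρu})` is
algebraically dependent and `u` is algebraic over it, then `(e^u, u)` has integer-polynomial simultaneous
approximations of quality `exp(−q^m)` and FIXED size exponent `Λ(f, S) ≤ q⁷` for unboundedly many `q`
(the Kummer specialisation of `pairApproxPoly_of_dependent`, with the size budget `budget_pairSize_seven`). -/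
theorem pairApproxOrd_of_dependent {u : ℂ} (hu0 : u ≠ 0) {ρ : ℝ} {m : ℕ} (hm2 : 2 ≤ m)
    (hρ : LiouvilleOrder (m + 6) ρ)
    (hρ0 : 0 < ρ) (hdep : ¬ AlgebraicIndependent ℚ ![cexp u, (ρ : ℂ), cexp (u * ρ)])
    (halg : IsAlgebraic (Algebra.adjoin ℚ (Set.range ![cexp u, (ρ : ℂ), cexp (u * ρ)])) u) :
    PairApproxOrd m u := by
  -- Step 0: the integer relations and the exponent bound
  obtain ⟨P₁, hP₁0, hP₁y⟩ := exists_int_mvRelation hdep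
  obtain ⟨L, Q, hQL, hQrel, hL⟩ := exists_int_mvRelation_alg halg
  set y : Fin 3 → ℂ := ![cexp u, (ρ : ℂ), cexp (u * ρ)] with hy
  obtain ⟨t, ht⟩ : ∃ t, t ∈ P₁.support := by
    obtain ⟨d, hd⟩ := MvPolynomial.ne_zero_iff.mp hP₁0
    exact ⟨d, MvPolynomial.mem_support_iff.mpr hd⟩
  obtain ⟨E, hE₁, hEQ, hE1⟩ := exists_common_degree_bound P₁ Q
  have hE₁1 : ∀ s ∈ P₁.support, s 1 ≤ E := fun s hs => hE₁ s hs 1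
  have hE₁02 : ∀ s ∈ P₁.support, s 0 ≤ E ∧ s 2 ≤ E := fun s hs => ⟨hE₁ s hs 0, hE₁ s hs 2⟩
  have hEQ1 : ∀ l, ∀ s ∈ (Q l).support, s 1 ≤ E := fun l s hs => hEQ l s hs 1
  have hEQ02 : ∀ l, ∀ s ∈ (Q l).support, s 0 ≤ E ∧ s 2 ≤ E :=
    fun l s hs => ⟨hEQ l s hs 0, hEQ l s hs 2⟩
  have hνpos : 0 < ‖u‖ := norm_pos_iff.mpr hu0
  obtain ⟨ν, hν⟩ : ∃ ν : ℝ, ν = ‖u‖ := ⟨_, rfl⟩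
  have hν0 : 0 < ν := by rw [hν]; exact hνpos
  obtain ⟨κ₀, hκ₀⟩ : ∃ κ : ℝ, κ = ‖MvPolynomial.aeval y (Q (Fin.last L))‖ := ⟨_, rfl⟩
  have hκ₀pos : 0 < κ₀ := by rw [hκ₀]; exact norm_pos_iff.mpr hQL
  obtain ⟨M, hMdef⟩ : ∃ M : ℝ, M = ‖cexp u‖ + ‖(ρ : ℂ)‖ + ‖cexp (u * ρ)‖ + 1 := ⟨_, rfl⟩
  have hy_norm1 : ∀ i, ‖y i‖ + 1 ≤ M := by
    intro i; rw [hMdef]; have := norm_vec3_le (a := cexp u) (b := (ρ : ℂ)) (c := cexp (u * ρ)) i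
    linarith
  have hy_norm : ∀ i, ‖y i‖ ≤ M := fun i => by linarith [hy_norm1 i]
  have hM1 : 1 ≤ M := by linarith [hy_norm1 0, norm_nonneg (y 0)]
  obtain ⟨Lip, hLip⟩ : ∃ l : ℝ, l = E * M ^ (3 * E) := ⟨_, rfl⟩
  have hLip0 : 0 < Lip := by
    rw [hLip]; have hE0 : (0 : ℝ) < E := by exact_mod_cast hE1
    positivity
  obtain ⟨ℓ₁, hℓ₁⟩ : ∃ l : ℝ, l = lenMv P₁ := ⟨_, rfl⟩
  have hℓ₁1 : 1 ≤ ℓ₁ := by rw [hℓ₁]; exact_mod_cast one_le_lenMv P₁ ht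
  obtain ⟨ℓQ, hℓQ⟩ : ∃ l : ℝ, l = ∑ l, (lenMv (Q l) : ℝ) := ⟨_, rfl⟩
  have hℓQ0 : 0 ≤ ℓQ := by rw [hℓQ]; exact Finset.sum_nonneg fun l _ => by exact_mod_cast lenMv_nonneg _
  have hℓQL : (lenMv (Q (Fin.last L)) : ℝ) ≤ ℓQ := by
    rw [hℓQ]
    exact Finset.single_le_sum (f := fun l => (lenMv (Q l) : ℝ))
      (fun l _ => by exact_mod_cast lenMv_nonneg _) (Finset.mem_univ _)
  obtain ⟨U, hU⟩ : ∃ U : ℝ, U = max 1 ‖u‖ ^ L := ⟨_, rfl⟩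
  have hU0 : 0 ≤ U := by rw [hU]; positivity
  obtain ⟨W, hW⟩ : ∃ W : ℝ, W = Real.exp ‖u‖ + 1 := ⟨_, rfl⟩
  have hW1 : 1 ≤ W := by rw [hW]; linarith [Real.exp_nonneg ‖u‖]
  obtain ⟨c₀, hc₀⟩ : ∃ c : ℕ, c = ⌈ρ⌉₊ + 2 := ⟨_, rfl⟩
  obtain ⟨K₁, hK₁⟩ : ∃ K : ℝ, K = ℓ₁ * (Lip * (1 + 2 * M * ν)) := ⟨_, rfl⟩
  have hK₁0 : 0 < K₁ := by rw [hK₁]; positivity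
  obtain ⟨K₂, hK₂⟩ : ∃ K : ℝ, K = 4 * (ℓQ * U * Lip) / κ₀ := ⟨_, rfl⟩
  have hK₂0 : 0 ≤ K₂ := by rw [hK₂]; positivity
  intro Nthr
  -- the threshold: a sum, so that each summand is `≤ q` linearly
  obtain ⟨K₇, hK₇⟩ : ∃ K : ℕ, K = (c₀ * E) ^ 2 * L * (c₀ * E + 2 * E + 2) *
      (4 * (c₀ * E) * E + 2 * (c₀ * E) + 1) := ⟨_, rfl⟩
  obtain ⟨q₀, hq₀def⟩ : ∃ q₀ : ℕ, q₀ = 4 + (m + 6) + Nthr + K₇ + (E + 1) + denBound (fibre P₁ (t 0) (t 2)) +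
      2 * c₀ + c₀ * E + (L + 1) + ⌈ν⌉₊ + (⌈1 / ν⌉₊ + 1) + (⌈1 / ρ⌉₊ + 1) + ⌈W⌉₊ + ⌈(c₀ : ℝ) * W⌉₊ +
      ⌈K₁⌉₊ + ⌈K₂⌉₊ + ⌈ℓ₁⌉₊ + ⌈ℓQ⌉₊ + ⌈1 + 2 * M * ν⌉₊ + ⌈4 * ℓQ * Lip / κ₀⌉₊ := ⟨_, rfl⟩
  obtain ⟨r, hden, hρr, hΔ⟩ := hρ q₀
  have hq4 : 4 ≤ r.den := by omega
  have hEq : E + 1 ≤ r.den := by omega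
  have hdBq : denBound (fibre P₁ (t 0) (t 2)) ≤ r.den := by omega
  have h2c₀q : 2 * c₀ ≤ r.den := by omega
  have hc₀Eq : c₀ * E ≤ r.den := by omega
  have hLq : L + 1 ≤ r.den := by omega
  have hνq : ⌈ν⌉₊ ≤ r.den := by omega
  have hiνq : ⌈1 / ν⌉₊ < r.den := by omega
  have hiρq : ⌈1 / ρ⌉₊ < r.den := by omega
  have hWq : ⌈W⌉₊ ≤ r.den := by omega
  have hcWq : ⌈(c₀ : ℝ) * W⌉₊ ≤ r.den := by omega
  have hK₁q : ⌈K₁⌉₊ ≤ r.den := by omega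
  have hK₂q : ⌈K₂⌉₊ ≤ r.den := by omega
  have hℓ₁q : ⌈ℓ₁⌉₊ ≤ r.den := by omega
  have hℓQq : ⌈ℓQ⌉₊ ≤ r.den := by omega
  have hMνq : ⌈1 + 2 * M * ν⌉₊ ≤ r.den := by omega
  have hκq : ⌈4 * ℓQ * Lip / κ₀⌉₊ ≤ r.den := by omega
  have hNq : Nthr ≤ r.den := by omega
  have hK₇q : K₇ ≤ r.den := by omega
  clear hq₀def
  set q : ℕ := r.den with hqdef
  have hq0 : q ≠ 0 := by omega
  obtain ⟨Qr, hQdef⟩ : ∃ Q : ℝ, Q = (q : ℝ) := ⟨_, rfl⟩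
  have hQ1 : (1 : ℝ) ≤ Qr := by rw [hQdef]; exact_mod_cast (show 1 ≤ q by omega)
  have hQ0 : (0 : ℝ) < Qr := by linarith
  have hQ2 : (2 : ℝ) ≤ Qr := by rw [hQdef]; exact_mod_cast (show 2 ≤ q by omega)
  have hQ3 : (3 : ℝ) ≤ Qr := by rw [hQdef]; exact_mod_cast (show 3 ≤ q by omega)
  have hνQ : ν ≤ Qr := by rw [hQdef]; exact Nat.ceil_le.mp hνq
  have hWQ : W ≤ Qr := by rw [hQdef]; exact Nat.ceil_le.mp hWq
  have hcWQ : (c₀ : ℝ) * W ≤ q := Nat.ceil_le.mp hcWq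
  have hK₁Q : K₁ ≤ Qr := by rw [hQdef]; exact Nat.ceil_le.mp hK₁q
  have hK₂Q : K₂ ≤ Qr := by rw [hQdef]; exact Nat.ceil_le.mp hK₂q
  have hℓ₁Q : ℓ₁ ≤ Qr := by rw [hQdef]; exact Nat.ceil_le.mp hℓ₁q
  have hℓQQ : ℓQ ≤ Qr := by rw [hQdef]; exact Nat.ceil_le.mp hℓQq
  have hMνQ : 1 + 2 * M * ν ≤ Qr := by rw [hQdef]; exact Nat.ceil_le.mp hMνq
  have hκQ : 4 * ℓQ * Lip / κ₀ ≤ Qr := by rw [hQdef]; exact Nat.ceil_le.mp hκq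
  have hc₀Q : (c₀ : ℝ) ≤ Qr := by rw [hQdef]; exact_mod_cast (show c₀ ≤ q by omega)
  have h2c₀Q : 2 * (c₀ : ℝ) ≤ Qr := by rw [hQdef]; exact_mod_cast h2c₀q
  have hc₀EQ : ((c₀ * E : ℕ) : ℝ) ≤ Qr := by rw [hQdef]; exact_mod_cast hc₀Eq
  have hLQ : (L : ℝ) + 1 ≤ Qr := by rw [hQdef]; exact_mod_cast hLq
  have hiνQ : Qr⁻¹ < ν := inv_lt_of_one_div_lt hν0 hQ0 (by rw [hQdef]; exact Nat.lt_of_ceil_lt hiνq)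
  have hiρQ : Qr⁻¹ < ρ := inv_lt_of_one_div_lt hρ0 hQ0 (by rw [hQdef]; exact Nat.lt_of_ceil_lt hiρq)
  -- the currency ε_k = exp(−Q^k)
  have hε_le : ∀ {j k : ℕ}, j ≤ k → Real.exp (-(Qr ^ k)) ≤ Real.exp (-(Qr ^ j)) :=
    fun h => exp_neg_pow_le_exp_neg_pow hQ1 h
  have hε_invQ : ∀ k : ℕ, 1 ≤ k → Real.exp (-(Qr ^ k)) ≤ Qr⁻¹ := by
    intro k hk
    refine (hε_le hk).trans ?_
    rw [pow_one, Real.exp_neg]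
    exact inv_anti₀ hQ0 (by linarith [Real.add_one_le_exp Qr])
  have hε_one : ∀ k : ℕ, Real.exp (-(Qr ^ k)) ≤ 1 := fun k => by
    rw [Real.exp_le_one_iff, neg_nonpos]; positivity
  obtain ⟨Δ, hΔdef⟩ : ∃ Δ : ℝ, Δ = |ρ - r| := ⟨_, rfl⟩
  rw [← hΔdef] at hΔ
  have hΔpos : 0 < Δ := by rw [hΔdef]; exact abs_pos.mpr (sub_ne_zero.mpr hρr)
  have hΔε : Δ < Real.exp (-(Qr ^ (m + 6))) := by rw [hQdef]; exact hΔ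
  have hΔQ : Δ < Qr⁻¹ := hΔε.trans_le (hε_invQ _ (by omega))
  have hΔ1 : Δ ≤ 1 := hΔQ.le.trans (inv_le_one_of_one_le₀ hQ1)
  have hνΔ : ν * Δ ≤ 1 := by
    calc ν * Δ ≤ Qr * Qr⁻¹ := mul_le_mul hνQ hΔQ.le hΔpos.le hQ0.le
      _ = 1 := mul_inv_cancel₀ hQ0.ne'
  obtain ⟨p, hpZ, hpq_nat, hpqC, hrpq⟩ :=
    natNum_of_close (show |ρ - r| ≤ 1 by rw [← hΔdef]; exact hΔ1)
      (show |ρ - r| < ρ by rw [← hΔdef]; exact hΔQ.trans hiρQ)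
  rw [← hc₀] at hpq_nat
  have hp_c₀q : p ≤ c₀ * q := le_trans (Nat.le_add_right p q) hpq_nat
  have hpQQ : (p : ℝ) + Qr ≤ Qr * Qr := by
    have h1 : ((p + q : ℕ) : ℝ) ≤ ((c₀ * q : ℕ) : ℝ) := by exact_mod_cast hpq_nat
    push_cast at h1
    rw [hQdef]
    exact h1.trans (by rw [← hQdef]; exact mul_le_mul_of_nonneg_right hc₀Q hQ0.le)
  have hΔC : ‖((p : ℂ) / (q : ℂ)) - (ρ : ℂ)‖ = Δ := by
    rw [← hpqC, ← Complex.ofReal_sub, Complex.norm_real, Real.norm_eq_abs, abs_sub_comm, hΔdef]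
  -- STEP A: the point v = e^{u/q}, the relation rA and its root γ
  set v : ℂ := cexp (u / q) with hvdef
  have hvq : v ^ q = cexp u := by
    rw [hvdef, ← Complex.exp_nat_mul, mul_div_cancel₀ _ (by exact_mod_cast hq0)]
  have hvp : v ^ p = cexp (p * (u / q)) := by rw [hvdef, ← Complex.exp_nat_mul]
  have hvW : ‖v‖ ≤ Real.exp ‖u‖ := norm_cexp_div_le u (by omega)
  have hexp' : ‖v ^ p - cexp (u * ρ)‖ ≤ M * (2 * (ν * Δ)) := by
    have hd : (p : ℂ) * (u / q) - u * ρ = u * ((p : ℂ) / (q : ℂ) - ρ) := by ring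
    have hnd : ‖(p : ℂ) * (u / q) - u * ρ‖ = ν * Δ := by rw [hd, norm_mul, hΔC, hν]
    rw [hvp]
    refine (norm_cexp_sub_cexp_le (by rw [hnd]; exact hνΔ)).trans ?_
    rw [hnd]
    exact mul_le_mul_of_nonneg_right (hy_norm 2) (by positivity)
  set xv : Fin 3 → ℂ := ![v ^ q, (p : ℂ) / q, v ^ p] with hxv
  have hsumA : ∑ i, ‖xv i - y i‖ ≤ (1 + 2 * M * ν) * Δ := by
    rw [Fin.sum_univ_three]
    show ‖v ^ q - cexp u‖ + ‖(p : ℂ) / q - (ρ : ℂ)‖ + ‖v ^ p - cexp (u * ρ)‖ ≤ _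
    rw [hvq, sub_self, norm_zero, zero_add, hΔC]
    have : M * (2 * (ν * Δ)) = 2 * M * ν * Δ := by ring
    linarith [hexp']
  have hxv_norm : ∀ i, ‖xv i‖ ≤ M := norm_le_of_sum_sub_le hy_norm1 hsumA
    (by calc (1 + 2 * M * ν) * Δ ≤ Qr * Qr⁻¹ := mul_le_mul hMνQ hΔQ.le hΔpos.le hQ0.le
          _ = 1 := mul_inv_cancel₀ hQ0.ne')
  set rA : ℤ[X] := kspec P₁ E p q with hrAdef
  have hrA0 : rA ≠ 0 := kspec_ne_zero P₁ ht hE₁1 r hpZ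
    (fun s hs => lt_of_le_of_lt (hE₁ s hs 2) (Nat.lt_of_succ_le hEq)) hdBq
  have hQE : ‖((q : ℂ)) ^ E‖ = Qr ^ E := by rw [norm_pow, Complex.norm_natCast, hQdef]
  have hval : ‖aeval v rA‖ ≤ Qr ^ E * K₁ * Δ := by
    rw [hrAdef, aeval_kspec P₁ hE₁1 p hq0 v, norm_mul, hQE, mul_assoc]
    refine mul_le_mul_of_nonneg_left ?_ (by positivity)
    rw [← sub_zero (MvPolynomial.aeval _ P₁), ← hP₁y]
    have h0 : (0 : ℝ) ≤ lenMv P₁ := by exact_mod_cast lenMv_nonneg _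
    calc ‖MvPolynomial.aeval xv P₁ - MvPolynomial.aeval y P₁‖
        ≤ lenMv P₁ * (E * M ^ (3 * E) * ∑ i, ‖xv i - y i‖) :=
          norm_mvAeval_sub_le P₁ hE₁ hM1 xv y hxv_norm hy_norm
      _ ≤ lenMv P₁ * (E * M ^ (3 * E) * ((1 + 2 * M * ν) * Δ)) := by gcongr
      _ = K₁ * Δ := by rw [hK₁, hℓ₁, hLip]; ring
  have hB₁ : Qr ^ E * K₁ ≤ Real.exp (Qr ^ (m + 5)) := by
    have h := prod4_le_exp_pow hq4 (show 3 ≤ m + 5 by omega) (pow_nonneg hQ0.le E) hK₁0.le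
      zero_le_one zero_le_one (by rw [hQdef]; exact natPow_le_exp_sq (by omega))
      (const_le_exp_sq (hQdef ▸ hK₁Q)) (const_le_exp_sq (by rw [← hQdef]; exact hQ1))
      (const_le_exp_sq (by rw [← hQdef]; exact hQ1))
    rw [mul_one, mul_one, ← hQdef] at h
    exact h
  have hvalε : ‖aeval v rA‖ < Real.exp (-(Qr ^ (m + 5))) := by
    have hpos : 0 < Qr ^ E * K₁ := by positivity
    calc ‖aeval v rA‖ ≤ Qr ^ E * K₁ * Δ := hval
      _ < Qr ^ E * K₁ * Real.exp (-(Qr ^ (m + 6))) := by gcongr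
      _ ≤ Real.exp (-(Qr ^ (m + 5))) := absorb hQ2 hB₁
  have hnA : 0 < rA.natDegree :=
    natDegree_pos_of_norm_aeval_lt_one hrA0 (hvalε.trans_le (hε_one _))
  have hNc : (q + p) * E ≤ (c₀ * E) * q := by
    calc (q + p) * E ≤ (c₀ * q) * E := Nat.mul_le_mul_right E (by rw [add_comm]; exact hpq_nat)
      _ = (c₀ * E) * q := by ring
  have hnA_c : rA.natDegree ≤ (c₀ * E) * q := (natDegree_kspec_le P₁ E p q hE₁02).trans hNc
  obtain ⟨γ, hγr, hγδ⟩ := exists_root_int_pow_le rA hnA v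
  have hδ : ‖v - γ‖ < Real.exp (-(Qr ^ (m + 3))) :=
    lt_eps_of_pow_le hQdef hQ1 hc₀EQ hnA_c (norm_nonneg _) hγδ hvalε
  have hδQ : ‖v - γ‖ < Qr⁻¹ := hδ.trans_le (hε_invQ _ (by omega))
  have hδ1 : ‖v - γ‖ ≤ 1 := hδQ.le.trans (inv_le_one_of_one_le₀ hQ1)
  have hγW : ‖γ‖ ≤ W := by
    calc ‖γ‖ = ‖v - (v - γ)‖ := by rw [sub_sub_cancel]
      _ ≤ ‖v‖ + ‖v - γ‖ := norm_sub_le _ _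
      _ ≤ Real.exp ‖u‖ + 1 := add_le_add hvW hδ1
      _ = W := hW.symm
  have hmax : max 1 (max ‖v‖ ‖γ‖) ≤ W := max_le hW1 (max_le (hvW.trans (by rw [hW]; linarith)) hγW)
  have hγ0 : γ ≠ 0 := by
    intro h
    rw [h, sub_zero] at hδQ
    have h1 : Real.exp (-‖u‖) ≤ ‖v‖ := exp_neg_norm_le_norm_cexp_div u q
    have h2 : Qr⁻¹ < Real.exp (-‖u‖) := by
      rw [Real.exp_neg]
      refine inv_strictAnti₀ (Real.exp_pos _) ?_
      calc Real.exp ‖u‖ < W := by rw [hW]; linarith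
        _ ≤ Qr := hWQ
    linarith
  -- α = γ^q, γ^p, and their distances
  have hαclose : ‖cexp u - γ ^ q‖ ≤ q * W ^ q * ‖v - γ‖ := by
    rw [← hvq]
    refine (norm_pow_sub_pow_le v γ q).trans ?_
    have h0 : (0:ℝ) ≤ ‖v - γ‖ := norm_nonneg _
    gcongr
  have hγp : ‖v ^ p - γ ^ p‖ ≤ p * W ^ p * ‖v - γ‖ := by
    refine (norm_pow_sub_pow_le v γ p).trans ?_
    gcongr
  have hT : ((q : ℝ) * W ^ q + p * W ^ p) * ‖v - γ‖ ≤ Real.exp (-(Qr ^ (m + 2))) :=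
    two_powers_absorb hQdef hq4 hm2 hW1 hp_c₀q (by omega) h2c₀Q hcWQ (norm_nonneg _) hδ.le
  have hTsplit : ((q : ℝ) * W ^ q + p * W ^ p) * ‖v - γ‖ =
      q * W ^ q * ‖v - γ‖ + p * W ^ p * ‖v - γ‖ := by ring
  have hαε : ‖cexp u - γ ^ q‖ ≤ Real.exp (-(Qr ^ (m + 2))) := by
    have h0 : (0:ℝ) ≤ p * W ^ p * ‖v - γ‖ := by positivity
    linarith
  -- the Step-B point xγ and its distance to y
  set xγ : Fin 3 → ℂ := ![γ ^ q, (p : ℂ) / q, γ ^ p] with hxγ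
  have hsumB : ∑ i, ‖xγ i - y i‖ ≤ 2 * Real.exp (-(Qr ^ (m + 2))) := by
    rw [Fin.sum_univ_three]
    show ‖γ ^ q - cexp u‖ + ‖(p : ℂ) / q - (ρ : ℂ)‖ + ‖γ ^ p - cexp (u * ρ)‖ ≤ _
    rw [hΔC, norm_sub_rev (γ ^ q) (cexp u)]
    have h1 : ‖γ ^ p - cexp (u * ρ)‖ ≤ p * W ^ p * ‖v - γ‖ + M * (2 * (ν * Δ)) := by
      calc ‖γ ^ p - cexp (u * ρ)‖ = ‖(γ ^ p - v ^ p) + (v ^ p - cexp (u * ρ))‖ := by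
            rw [sub_add_sub_cancel]
        _ ≤ ‖γ ^ p - v ^ p‖ + ‖v ^ p - cexp (u * ρ)‖ := norm_add_le _ _
        _ ≤ p * W ^ p * ‖v - γ‖ + M * (2 * (ν * Δ)) := by
            rw [norm_sub_rev (γ ^ p) (v ^ p)]; exact add_le_add hγp hexp'
    have h2 : (1 + 2 * M * ν) * Δ ≤ Real.exp (-(Qr ^ (m + 2))) := by
      calc (1 + 2 * M * ν) * Δ ≤ (1 + 2 * M * ν) * Real.exp (-(Qr ^ (m + 3))) := by
            gcongr; exact hΔε.le.trans (hε_le (show m + 3 ≤ m + 6 by omega))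
        _ ≤ Real.exp (-(Qr ^ (m + 2))) := by
            refine absorb hQ2 (hMνQ.trans ?_)
            calc Qr ≤ Qr + 1 := by linarith
              _ ≤ Real.exp Qr := Real.add_one_le_exp Qr
              _ ≤ Real.exp (Qr ^ (m + 2)) := by
                  rw [Real.exp_le_exp]
                  calc Qr = Qr ^ 1 := (pow_one Qr).symm
                    _ ≤ Qr ^ (m + 2) := pow_le_pow_right₀ hQ1 (by omega)
    have e2 : M * (2 * (ν * Δ)) = 2 * M * ν * Δ := by ring
    have e3 : (1 + 2 * M * ν) * Δ = Δ + 2 * M * ν * Δ := by ring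
    linarith [hαclose, h1, hT, h2]
  have h2ε1 : 2 * Real.exp (-(Qr ^ (m + 2))) ≤ 1 := by
    have := exp_neg_pow_add_two_le_half hQ2 m
    linarith [hε_one m]
  have hxγ_norm : ∀ i, ‖xγ i‖ ≤ M := norm_le_of_sum_sub_le hy_norm1 hsumB h2ε1
  -- STEP B: the family H, its top coefficient at γ, and the root β of the specialised relation
  set H : Fin (L + 1) → ℤ[X] := fun l => kspec (Q l) E p q with hHdef
  have hHN : ∀ l, (H l).natDegree ≤ (q + p) * E := fun l => natDegree_kspec_le (Q l) E p q (hEQ02 l)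
  have htop_ge : κ₀ / 2 ≤ ‖aeval γ (H (Fin.last L))‖ := by
    have e1 : aeval γ (H (Fin.last L)) = (q : ℂ) ^ E * MvPolynomial.aeval xγ (Q (Fin.last L)) := by
      show aeval γ (kspec (Q (Fin.last L)) E p q) = _
      rw [aeval_kspec (Q (Fin.last L)) (hEQ1 _) p hq0 γ]
    rw [e1, norm_mul, hQE]
    have hdiff : ‖MvPolynomial.aeval xγ (Q (Fin.last L)) - MvPolynomial.aeval y (Q (Fin.last L))‖
        ≤ ℓQ * (Lip * (2 * Real.exp (-(Qr ^ (m + 2))))) := by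
      refine (norm_mvAeval_sub_le (Q (Fin.last L)) (hEQ _) hM1 xγ y hxγ_norm hy_norm).trans ?_
      rw [← hLip]
      gcongr
    have h := half_le_norm_of_close hκ₀ hκ₀pos hQ0 hℓQ0 hLip0.le hdiff (hε_invQ _ (by omega)) hκQ
    calc κ₀ / 2 = 1 * (κ₀ / 2) := by ring
      _ ≤ Qr ^ E * ‖MvPolynomial.aeval xγ (Q (Fin.last L))‖ :=
          mul_le_mul (one_le_pow₀ hQ1) h (by positivity) (by positivity)
  have htop0 : aeval γ (H (Fin.last L)) ≠ 0 := by
    intro h; rw [h, norm_zero] at htop_ge; linarith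
  have hQrel' : ∑ l, MvPolynomial.aeval y (Q l) * u ^ (l : ℕ) = 0 := hQrel
  have hsu : ‖(conjFactor H γ).eval u‖ ≤
      (Qr ^ E * (ℓQ * U * Lip)) * (2 * Real.exp (-(Qr ^ (m + 2)))) := by
    rw [hHdef, eval_conjFactor_kspec Q hEQ1 p hq0 γ u, norm_mul, hQE, mul_assoc]
    refine mul_le_mul_of_nonneg_left ?_ (by positivity)
    refine (norm_sum_aeval_sub_le Q hEQ hM1 xγ y hxγ_norm hy_norm u hQrel').trans ?_
    rw [← hℓQ, ← hU, ← hLip]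
    calc ℓQ * U * (Lip * ∑ i, ‖xγ i - y i‖) ≤ ℓQ * U * (Lip * (2 * Real.exp (-(Qr ^ (m + 2))))) := by
          gcongr
      _ = ℓQ * U * Lip * (2 * Real.exp (-(Qr ^ (m + 2)))) := by ring
  obtain ⟨β, hβroot, hβpow⟩ := exists_root_conjFactor_pow_le H hL htop0 u
  have hβL : ‖u - β‖ ^ L ≤ Real.exp (-(Qr ^ (m + 1))) := by
    have h1 : κ₀ / 2 * ‖u - β‖ ^ L ≤ (Qr ^ E * (ℓQ * U * Lip)) * (2 * Real.exp (-(Qr ^ (m + 2)))) := by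
      calc κ₀ / 2 * ‖u - β‖ ^ L ≤ ‖aeval γ (H (Fin.last L))‖ * ‖u - β‖ ^ L := by gcongr
        _ ≤ _ := hβpow.trans hsu
    have h2 := le_of_half_mul_le hκ₀pos h1
    have e : 4 * (Qr ^ E * (ℓQ * U * Lip)) / κ₀ = K₂ * Qr ^ E := by rw [hK₂]; ring
    rw [e] at h2
    refine h2.trans (absorb hQ2 ?_)
    have h := prod4_le_exp_pow hq4 (show 3 ≤ m + 1 by omega) hK₂0 (pow_nonneg hQ0.le E)
      zero_le_one zero_le_one (const_le_exp_sq (hQdef ▸ hK₂Q))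
      (by rw [hQdef]; exact natPow_le_exp_sq (by omega))
      (const_le_exp_sq (by rw [← hQdef]; exact hQ1)) (const_le_exp_sq (by rw [← hQdef]; exact hQ1))
    rw [mul_one, mul_one, ← hQdef] at h
    exact h
  have hβclose : ‖u - β‖ < Real.exp (-(Qr ^ m)) / 2 :=
    lt_half_eps_of_pow_le hL hLQ (by omega) (norm_nonneg _) hβL
  have hβ0 : β ≠ 0 := by
    intro h
    rw [h, sub_zero] at hβclose
    have h1 : Real.exp (-(Qr ^ m)) / 2 ≤ Qr⁻¹ := by
      have := hε_invQ m (by omega)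
      linarith [Real.exp_nonneg (-(Qr ^ m))]
    rw [← hν] at hβclose
    linarith
  -- the integer polynomials: S for α (from rA), f for β (from an irreducible factor r₁ of rA at γ)
  obtain ⟨hS0, hSα, hdegS, hMS⟩ := alpha_poly rA hrA0 hγr q
  obtain ⟨r₁, hr₁irr, hr₁deg, hr₁γ, hr₁le, hMr₁⟩ := irreducible_package hrA0 hγr
  obtain ⟨hf₀0, hf₀β, hdegf₀, hMf₀⟩ := beta_poly hr₁irr hr₁deg hr₁γ H hHN htop0 hβroot
  obtain ⟨f, hfirr, hfdeg, hfβ, hfle, hMf⟩ := irreducible_package hf₀0 hf₀β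
  have hlenA : ((len rA : ℤ) : ℝ) ≤ ℓ₁ * ((p : ℝ) + Qr) ^ E := by
    have := len_kspec_le P₁ hE₁1 p q
    rw [hℓ₁, hQdef]; exact_mod_cast this
  have hpow : Qr * (Qr * Qr) ^ E = Qr ^ (2 * E + 1) := by rw [← sq, ← pow_mul]; ring
  have hMrA : (rA.map (Int.castRingHom ℂ)).mahlerMeasure ≤ Qr ^ (2 * E + 1) := by
    refine (Literature.NumberTheory.Transcendental.NesterenkoWaldschmidt1996.mahlerMeasure_le_length
      rA).trans (hlenA.trans ?_)
    calc ℓ₁ * ((p : ℝ) + Qr) ^ E ≤ Qr * (Qr * Qr) ^ E := by gcongr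
      _ = Qr ^ (2 * E + 1) := hpow
  have hRH : relLen H ≤ Qr ^ (2 * E + 1) := by
    refine (relLen_kspec_le Q hEQ1 p q).trans ?_
    rw [← hℓQ, ← hQdef]
    calc ℓQ * ((p : ℝ) + Qr) ^ E ≤ Qr * (Qr * Qr) ^ E := by gcongr
      _ = Qr ^ (2 * E + 1) := hpow
  have hRH1 : 1 ≤ relLen H := one_le_relLen H (fun h => htop0 (by rw [h, map_zero]))
  have hK₇Q : ((((c₀ * E) ^ 2 * L * (c₀ * E + 2 * E + 2) *
      (4 * (c₀ * E) * E + 2 * (c₀ * E) + 1) : ℕ)) : ℝ) ≤ Qr := by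
    rw [hQdef, ← hK₇]; exact_mod_cast hK₇q
  have hsize : pairSize f (resPoly rA (kumY q) q) ≤ Qr ^ 7 := by
    unfold pairSize
    exact budget_pairSize_seven hQ3 hQdef hnA_c hr₁le ((hNc.trans le_rfl))
      hdegS (hfle.trans hdegf₀) (one_le_mahlerMeasure_of_ne_zero hS0) hMS (one_le_mahlerMeasure_of_ne_zero hrA0)
      hMrA (one_le_mahlerMeasure_of_ne_zero hfirr.ne_zero) (hMf.trans hMf₀) hRH1 hRH
      (one_le_mahlerMeasure_of_ne_zero hr₁irr.ne_zero) hMr₁ hK₇Q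
  refine ⟨q, hNq, f, resPoly rA (kumY q) q, γ ^ q, β, hfirr, hfdeg, hS0, hfβ, hSα,
    pow_ne_zero _ hγ0, hβ0, by rw [← hQdef]; exact hsize, ?_⟩
  rw [← hQdef]
  have h1 : ‖cexp u - γ ^ q‖ ≤ Real.exp (-(Qr ^ m)) / 2 :=
    hαε.trans (exp_neg_pow_add_two_le_half hQ2 m)
  linarith

end Summit.Schanuel.Schanuel.Theorems.RootDecomp1KGeneric
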